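import Summits.CriticalPhenomena.CardyFormulaZ2.Theorems.CardyIKTransportIKLinearTransportTwoCutComb

/-!
# Stub `stub_TwoCutComb` — part 2: assembly of the upper half-diagram (D), rigidity of the window
# reachability (B), and the registered `stub_TwoCutComb`

Support file (`--supports stmt-CriticalPhenomena-5076`, registered stub `stub_TwoCutComb : ∀ i, TwoCutComb i`).

* `tc_UpDp_eq_comb2` — (D): between two cut rows `c < c'`, the upper half-diagram with pivot at `c` is assembled
  (`TcComb2`) from the boundary/pivot window reachability `cmkRWp i c c' x` and the upper half-diagram with pivot at
  `c'` (split a path at the row `c'`, no crossing at `c'` on either side);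
* `tc_RWp_rigid` — (B): the boundary/pivot window reachability is a function of the strip diagram on the pairs with
  rows in `[c-2, c'+2]` (`tc_RW_bd_iff`, `tc_RW_piv_iff`, `tc_RW_piv'_iff`, `tc_RW_pivpiv_iff`), hence rigid under
  `EnvAgree i (c-2) (c'+2)`;
* `stub_TwoCutComb` — (C) `tc_twoCut_iff`, (D), (B), (E) `tc_RW_flat` assembled.
-/

noncomputable section

namespace Summit.CriticalPhenomena.CardyFormulaZ2.Theorems.IKLinearTransport.PinnedDiagramExchange

open scoped Classical MeasureTheory ENNReal symmDiff
open Set MeasureTheory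
open Literature.Probability.Percolation Literature.Probability.LatticeModels

/-! ## (D) Assembly of the upper half-diagram with pivot at `c` -/

/-- A boundary-or-lower-pivot cell of row `≥ c' > c` is a boundary-or-upper-pivot cell. [folklore] -/
theorem tc_bdp_up {i c c' : ℤ} (hcc' : c < c') {P : Site 2} (hP : cmkBdp i c P) (hP1 : c' ≤ P 1) : cmkBdp i c' P := by
  rcases hP with hP | rfl
  · exact Or.inl hP
  · simp only [Matrix.cons_val_one, Matrix.cons_val_zero] at hP1; omega

/-- (D) ASSEMBLY: between two cut rows `c ≤ -1 < 1 ≤ c'`, the upper half-diagram with pivot at `c` is assembled from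
the boundary/pivot window reachability of the rows `[c, c']` and the upper half-diagram with pivot at `c'`. [folklore] -/
theorem tc_UpDp_eq_comb2 {i c c' : ℤ} {x : Obs} (hc : c ≤ -1) (hc' : 1 ≤ c') (h2 : IsCut i c' (pinnedStat i x)) :
    cmkUpDp i c x = TcComb2 i c c' (cmkRWp i c c' x) (cmkUpDp i c' x) := by
  have hcc' : c ≤ c' := by omega
  have hlt : c < c' := by omega
  ext ⟨P, Q⟩
  simp only [TcComb2, mem_setOf_eq]
  constructor
  · rintro ⟨hbP, hbQ, hU⟩
    dsimp only at hbP hbQ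
    refine ⟨hbP, hbQ, ?_⟩
    obtain ⟨⟨hq, hqc⟩, ⟨hp, hpc⟩, hr⟩ := (cmk_mem_UpR_iff _ _ _ _ _).1 hU
    by_cases hP1 : P 1 ≤ c' <;> by_cases hQ1 : Q 1 ≤ c'
    · -- both ends below `c'`: the path stays in the window
      have hr' := tc_cut_noCrossUp h2 hr inter_subset_left ⟨hp, hpc⟩ hP1 hQ1
      have hPQ : (P, Q) ∈ cmkRWp i c c' x := ⟨Or.inl hbP, Or.inl hbQ, (tc_mem_RW_iff _ _ _ _ _ _).2
        ⟨⟨hq, hqc, hQ1⟩, ⟨hp, hpc, hP1⟩, SDE.within_mono _ (tc_sub_up _ _ _) hr'⟩⟩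
      exact Or.inl ⟨hP1, hQ1, hPQ⟩
    · -- ascending straddle: split at the row `c'`
      obtain ⟨X, hX1, hX2, hX3⟩ := cmk_exists_row_split _ (fun v : Site 2 => v 1)
        (fun u v huv => (cmk_within_rows _ _ u v huv).1) hr c' hP1 (by omega)
      have hXs : X ∈ SDE.cls x i P ∩ {v | c ≤ v 1} := SDE.within_reachable_mem _ _ hX1 ⟨hp, hpc⟩
      have hbX : cmkBdp i c' X := cmk_bdp_of_rowc hXs.1.2.1 hXs.1.2.2 hX3
      have hbQ' : cmkBdp i c' Q := tc_bdp_up hlt hbQ (by omega)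
      have e := cmk_cls_eq_of_mem hXs.1
      have hPX : (P, X) ∈ cmkRWp i c c' x := by
        have hr' := tc_cut_noCrossUp h2 hX1 inter_subset_left ⟨hp, hpc⟩ hP1 hX3.le
        exact ⟨Or.inl hbP, Or.inr hbX, (tc_mem_RW_iff _ _ _ _ _ _).2 ⟨⟨hXs.1, hXs.2, hX3.le⟩, ⟨hp, hpc, hP1⟩,
          SDE.within_mono _ (tc_sub_up _ _ _) hr'⟩⟩
      have hXQ : (X, Q) ∈ cmkUpDp i c' x := by
        have hr' := tc_cut_noCrossDown h2 hX2 inter_subset_left hXs hX3.ge (by omega)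
        refine ⟨hbX, hbQ', ?_⟩
        rw [cmk_mem_UpR_iff, e]
        exact ⟨⟨hq, by omega⟩, ⟨hXs.1, hX3.ge⟩, SDE.within_mono _ (tc_sub_right _ _ _) hr'⟩
      exact Or.inr (Or.inr (Or.inl ⟨X, hX3, hPX, hXQ⟩))
    · -- descending straddle
      obtain ⟨X, hX1, hX2, hX3⟩ := cmk_exists_row_split' _ (fun v : Site 2 => v 1)
        (fun u v huv => (cmk_within_rows _ _ u v huv).2) hr c' (by omega) hQ1
      have hXs : X ∈ SDE.cls x i P ∩ {v | c ≤ v 1} := SDE.within_reachable_mem _ _ hX1 ⟨hp, hpc⟩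
      have hbX : cmkBdp i c' X := cmk_bdp_of_rowc hXs.1.2.1 hXs.1.2.2 hX3
      have hbP' : cmkBdp i c' P := tc_bdp_up hlt hbP (by omega)
      have e := cmk_cls_eq_of_mem hXs.1
      have hPX : (P, X) ∈ cmkUpDp i c' x := by
        have hr' := tc_cut_noCrossDown h2 hX1 inter_subset_left ⟨hp, hpc⟩ (by omega) hX3.ge
        refine ⟨hbP', hbX, ?_⟩
        rw [cmk_mem_UpR_iff]
        exact ⟨⟨hXs.1, hX3.ge⟩, ⟨hp, by omega⟩, SDE.within_mono _ (tc_sub_right _ _ _) hr'⟩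
      have hXQ : (X, Q) ∈ cmkRWp i c c' x := by
        have hr' := tc_cut_noCrossUp h2 hX2 inter_subset_left hXs hX3.le hQ1
        refine ⟨Or.inr hbX, Or.inl hbQ, ?_⟩
        rw [tc_mem_RW_iff, e]
        exact ⟨⟨hq, hqc, hQ1⟩, ⟨hXs.1, hXs.2, hX3.le⟩, SDE.within_mono _ (tc_sub_up _ _ _) hr'⟩
      exact Or.inr (Or.inr (Or.inr ⟨X, hX3, hPX, hXQ⟩))
    · -- both ends above `c'`
      have hbP' : cmkBdp i c' P := tc_bdp_up hlt hbP (by omega)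
      have hbQ' : cmkBdp i c' Q := tc_bdp_up hlt hbQ (by omega)
      have hPQ : (P, Q) ∈ cmkUpDp i c' x := by
        have hr' := tc_cut_noCrossDown h2 hr inter_subset_left ⟨hp, hpc⟩ (by omega) (by omega)
        refine ⟨hbP', hbQ', ?_⟩
        rw [cmk_mem_UpR_iff]
        exact ⟨⟨hq, by omega⟩, ⟨hp, by omega⟩, SDE.within_mono _ (tc_sub_right _ _ _) hr'⟩
      exact Or.inr (Or.inl ⟨by omega, by omega, hPQ⟩)
  · rintro ⟨hbP, hbQ, hcase⟩
    refine ⟨hbP, hbQ, ?_⟩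
    have hLU : ∀ {pq : Site 2 × Site 2}, pq ∈ cmkRWp i c c' x → pq ∈ cmkUpR i c x := fun hpq =>
      tc_RW_sub_UpR i hcc' x hpq.2.2
    have hDU : ∀ {pq : Site 2 × Site 2}, pq ∈ cmkUpDp i c' x → pq ∈ cmkUpR i c x := fun hpq =>
      tc_UpR_anti i hcc' x hpq.2.2
    rcases hcase with ⟨-, -, hL⟩ | ⟨-, -, hU⟩ | ⟨X, -, hL, hU⟩ | ⟨X, -, hU, hL⟩
    · exact hLU hL
    · exact hDU hU
    · exact cmk_UpR_trans (hLU hL) (hDU hU)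
    · exact cmk_UpR_trans (hDU hU) (hLU hL)

/-! ## (B) The boundary/pivot window reachability is read off the strip diagram -/

section Rigid

variable {i c c' : ℤ} {x : Obs}

/-- Between two cut rows, two boundary cells of the window are joined inside the window iff in the strip. [folklore] -/
theorem tc_RW_bd_iff (h1 : IsCut i c (pinnedStat i x)) (h2 : IsCut i c' (pinnedStat i x)) {P Q : Site 2}
    (hP : cmkBd i P) (hQ : cmkBd i Q) (hP1 : c ≤ P 1) (hP2 : P 1 ≤ c') (hQ1 : c ≤ Q 1) (hQ2 : Q 1 ≤ c') :
    (P, Q) ∈ cmkRW i c c' x ↔ (P, Q) ∈ stripDiagram i x := by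
  rw [tc_mem_RW_iff]
  constructor
  · rintro ⟨⟨hq, -⟩, -, hr⟩
    exact cmk_mem_stripDiagram_of_within hP hQ hq inter_subset_left hr
  · intro hD
    rw [SDE.mem_stripDiagram_iff] at hD
    obtain ⟨-, -, hq, hp, hr⟩ := hD
    have hr1 := tc_cut_noCrossDown h1 hr Subset.rfl hp hP1 hQ1
    have hr2 := tc_cut_noCrossUp h2 hr1 inter_subset_left ⟨hp, hP1⟩ hP2 hQ2
    exact ⟨⟨hq, hQ1, hQ2⟩, ⟨hp, hP1, hP2⟩, SDE.within_mono _ (tc_sub_up _ _ _) hr2⟩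

/-- Between two cut rows, the lower pivot is joined inside the window to a boundary cell `Q` of the window iff
`((i, c-2), Q)` is in the strip diagram. [folklore] -/
theorem tc_RW_piv_iff (hcc' : c ≤ c') (h1 : IsCut i c (pinnedStat i x)) (h2 : IsCut i c' (pinnedStat i x))
    {Q : Site 2} (hQ : cmkBd i Q) (hQ1 : c ≤ Q 1) (hQ2 : Q 1 ≤ c') :
    ((![i + 1, c] : Site 2), Q) ∈ cmkRW i c c' x ↔ ((![i, c - 2] : Site 2), Q) ∈ stripDiagram i x := by
  constructor
  · intro hW
    exact ((cmk_isCut_pivQ h1 hQ).1 (tc_RW_sub_UpR i hcc' x hW)).2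
  · intro hD
    obtain ⟨⟨hq, hqc⟩, ⟨hp, hpc⟩, hr⟩ := (cmk_mem_UpR_iff _ _ _ _ _).1 ((cmk_isCut_pivQ h1 hQ).2 ⟨hQ1, hD⟩)
    have hr' := tc_cut_noCrossUp h2 hr inter_subset_left ⟨hp, hpc⟩ (by simp only [Matrix.cons_val_one, Matrix.cons_val_zero]; omega) hQ2
    exact (tc_mem_RW_iff _ _ _ _ _ _).2 ⟨⟨hq, hqc, hQ2⟩, ⟨hp, hpc, by simp only [Matrix.cons_val_one, Matrix.cons_val_zero]; omega⟩,
      SDE.within_mono _ (tc_sub_up _ _ _) hr'⟩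

/-- Between two cut rows, the upper pivot is joined inside the window to a boundary cell `Q` of the window iff
`((i, c'+2), Q)` is in the strip diagram. [folklore] -/
theorem tc_RW_piv'_iff (hcc' : c ≤ c') (h1 : IsCut i c (pinnedStat i x)) (h2 : IsCut i c' (pinnedStat i x))
    {Q : Site 2} (hQ : cmkBd i Q) (hQ1 : c ≤ Q 1) (hQ2 : Q 1 ≤ c') :
    ((![i + 1, c'] : Site 2), Q) ∈ cmkRW i c c' x ↔ ((![i, c' + 2] : Site 2), Q) ∈ stripDiagram i x := by
  constructor
  · intro hW
    exact ((tc_isCut_pivQ_down h2 hQ).1 (tc_RW_sub_LoR i hcc' x hW)).2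
  · intro hD
    obtain ⟨⟨hq, hqc⟩, ⟨hp, hpc⟩, hr⟩ := (cmk_mem_LoR_iff _ _ _ _ _).1 ((tc_isCut_pivQ_down h2 hQ).2 ⟨hQ2, hD⟩)
    have hr' := tc_cut_noCrossDown h1 hr inter_subset_left ⟨hp, hpc⟩ (by simp only [Matrix.cons_val_one, Matrix.cons_val_zero]; omega) hQ1
    exact (tc_mem_RW_iff _ _ _ _ _ _).2 ⟨⟨hq, hQ1, hqc⟩, ⟨hp, by simp only [Matrix.cons_val_one, Matrix.cons_val_zero]; omega, hpc⟩,
      SDE.within_mono _ (tc_sub_down _ _ _) hr'⟩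

/-- Between two cut rows, the two pivots are joined inside the window iff `((i, c-2), (i, c'+2))` is in the strip
diagram. [folklore] -/
theorem tc_RW_pivpiv_iff (hcc' : c ≤ c') (h1 : IsCut i c (pinnedStat i x)) (h2 : IsCut i c' (pinnedStat i x)) :
    ((![i + 1, c] : Site 2), (![i + 1, c'] : Site 2)) ∈ cmkRW i c c' x ↔
      ((![i, c - 2] : Site 2), (![i, c' + 2] : Site 2)) ∈ stripDiagram i x := by
  obtain ⟨hpat', -, -⟩ := (cmk_isCut_iff_pattern i c' x).1 h2
  obtain ⟨hlo, -⟩ := cmk_isCut_piv h1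
  obtain ⟨-, hup'⟩ := cmk_isCut_piv h2
  obtain ⟨⟨hpiv, -⟩, ⟨hp0, -⟩, hr1⟩ := (cmk_mem_LoR_iff _ _ _ _ _).1 hlo
  obtain ⟨⟨htop, -⟩, -, hr3⟩ := (cmk_mem_UpR_iff _ _ _ _ _).1 hup'
  have e1 := cmk_cls_eq_of_mem hpiv
  constructor
  · intro hW
    rw [tc_mem_RW_iff, e1] at hW
    obtain ⟨⟨hpiv', -⟩, -, hr2⟩ := hW
    have e2 := cmk_cls_eq_of_mem hpiv'
    rw [e2] at htop hr3
    exact cmk_mem_stripDiagram_of_within (Or.inl (by simp)) (Or.inl (by simp)) htop subset_rfl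
      (((SDE.within_mono _ inter_subset_left hr1).trans (SDE.within_mono _ inter_subset_left hr2)).trans
        (SDE.within_mono _ inter_subset_left hr3))
  · intro hD
    have hU := (cmk_isCut_pivQ h1 (Q := ![i, c' + 2]) (Or.inl (by simp))).2 ⟨by simp only [Matrix.cons_val_one, Matrix.cons_val_zero]; omega, hD⟩
    obtain ⟨-, ⟨hp, hpc⟩, hr⟩ := (cmk_mem_UpR_iff _ _ _ _ _).1 hU
    obtain ⟨w, hw1, -, hw3⟩ := cmk_exists_row_split _ (fun v : Site 2 => v 1)
      (fun u v huv => (cmk_within_rows _ _ u v huv).1) hr c' (by simp only [Matrix.cons_val_one, Matrix.cons_val_zero]; omega) (by simp only [Matrix.cons_val_one, Matrix.cons_val_zero]; omega)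
    have hw : w ∈ SDE.cls x i ![i + 1, c] ∩ {v | c ≤ v 1} := SDE.within_reachable_mem _ _ hw1 ⟨hp, hpc⟩
    have hD' := hD
    rw [SDE.mem_stripDiagram_iff] at hD'
    obtain ⟨-, -, htop2, -, -⟩ := hD'
    have e3 : SDE.cls x i ![i, c' - 2] = SDE.cls x i ![i + 1, c] := by
      rw [e1]; ext v; simp only [SDE.cls, mem_setOf_eq, hpat'.2.1, ← hpat'.2.2, htop2.1]
    have hwp : w = ![i + 1, c'] := cmk_rowc_eq_piv hpat' (by rw [e3]; exact hw.1) hw3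
    subst hwp
    have hr' := tc_cut_noCrossUp h2 hw1 inter_subset_left ⟨hp, hpc⟩ (by simp only [Matrix.cons_val_one, Matrix.cons_val_zero]; omega)
      (by simp only [Matrix.cons_val_one, Matrix.cons_val_zero]; omega)
    exact (tc_mem_RW_iff _ _ _ _ _ _).2 ⟨⟨hw.1, hw.2, by simp only [Matrix.cons_val_one, Matrix.cons_val_zero]; omega⟩,
      ⟨hp, hpc, by simp only [Matrix.cons_val_one, Matrix.cons_val_zero]; omega⟩, SDE.within_mono _ (tc_sub_up _ _ _) hr'⟩

/-- (B), one inclusion: the boundary/pivot window reachability transfers along `EnvAgree i (c-2) (c'+2)` between two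
configurations with the cut rows `c ≤ c'`. [folklore] -/
theorem tc_RWp_sub {x' : Obs} (hcc' : c ≤ c') (h1 : IsCut i c (pinnedStat i x)) (h2 : IsCut i c' (pinnedStat i x))
    (h1' : IsCut i c (pinnedStat i x')) (h2' : IsCut i c' (pinnedStat i x'))
    (hag : EnvAgree i (c - 2) (c' + 2) (pinnedStat i x) (pinnedStat i x')) : cmkRWp i c c' x ⊆ cmkRWp i c c' x' := by
  have hΔ : ∀ P Q : Site 2, c - 2 ≤ P 1 → P 1 ≤ c' + 2 → c - 2 ≤ Q 1 → Q 1 ≤ c' + 2 →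
      ((P, Q) ∈ stripDiagram i x ↔ (P, Q) ∈ stripDiagram i x') := fun P Q a b d e => hag.2 (P, Q) a b d e
  -- transfer of a pair (boundary or pivot, boundary)
  have core : ∀ P Q : Site 2, (cmkBd i P ∨ P = ![i + 1, c] ∨ P = ![i + 1, c']) → cmkBd i Q →
      (P, Q) ∈ cmkRW i c c' x → (P, Q) ∈ cmkRW i c c' x' := by
    intro P Q hP hQ hW
    obtain ⟨⟨-, hQ1, hQ2⟩, ⟨-, hP1, hP2⟩, -⟩ := (tc_mem_RW_iff _ _ _ _ _ _).1 hW
    rcases hP with hP | rfl | rfl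
    · rw [tc_RW_bd_iff h1' h2' hP hQ hP1 hP2 hQ1 hQ2, ← hΔ P Q (by omega) (by omega) (by omega) (by omega)]
      exact (tc_RW_bd_iff h1 h2 hP hQ hP1 hP2 hQ1 hQ2).1 hW
    · rw [tc_RW_piv_iff hcc' h1' h2' hQ hQ1 hQ2, ← hΔ _ Q (by simp only [Matrix.cons_val_one, Matrix.cons_val_zero]; omega) (by simp only [Matrix.cons_val_one, Matrix.cons_val_zero]; omega)
        (by omega) (by omega)]
      exact (tc_RW_piv_iff hcc' h1 h2 hQ hQ1 hQ2).1 hW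
    · rw [tc_RW_piv'_iff hcc' h1' h2' hQ hQ1 hQ2, ← hΔ _ Q (by simp only [Matrix.cons_val_one, Matrix.cons_val_zero]; omega) (by simp only [Matrix.cons_val_one, Matrix.cons_val_zero]; omega)
        (by omega) (by omega)]
      exact (tc_RW_piv'_iff hcc' h1 h2 hQ hQ1 hQ2).1 hW
  have hpp : ((![i, c - 2] : Site 2), (![i, c' + 2] : Site 2)) ∈ stripDiagram i x →
      ((![i, c - 2] : Site 2), (![i, c' + 2] : Site 2)) ∈ stripDiagram i x' :=
    (hΔ _ _ (by simp only [Matrix.cons_val_one, Matrix.cons_val_zero]; omega) (by simp only [Matrix.cons_val_one, Matrix.cons_val_zero]; omega) (by simp only [Matrix.cons_val_one, Matrix.cons_val_zero]; omega)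
      (by simp only [Matrix.cons_val_one, Matrix.cons_val_zero]; omega)).1
  -- transfer of any pair of boundary-or-pivot cells
  have core2 : ∀ P Q : Site 2, (cmkBd i P ∨ P = ![i + 1, c] ∨ P = ![i + 1, c']) →
      (cmkBd i Q ∨ Q = ![i + 1, c] ∨ Q = ![i + 1, c']) → (P, Q) ∈ cmkRW i c c' x → (P, Q) ∈ cmkRW i c c' x' := by
    intro P Q hP hQ hW
    rcases hQ with hQ | rfl | rfl
    · exact core P Q hP hQ hW
    · rcases hP with hP | rfl | rfl
      · exact tc_RW_symm (core _ P (Or.inr (Or.inl rfl)) hP (tc_RW_symm hW))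
      · exact tc_RW_refl x' (by simp only [Matrix.cons_val_zero]; omega) (by simp only [Matrix.cons_val_zero]; omega) (by simp only [Matrix.cons_val_one, Matrix.cons_val_zero]; omega)
          (by simp only [Matrix.cons_val_one, Matrix.cons_val_zero]; omega)
      · exact tc_RW_symm ((tc_RW_pivpiv_iff hcc' h1' h2').2 (hpp ((tc_RW_pivpiv_iff hcc' h1 h2).1 (tc_RW_symm hW))))
    · rcases hP with hP | rfl | rfl
      · exact tc_RW_symm (core _ P (Or.inr (Or.inr rfl)) hP (tc_RW_symm hW))
      · exact (tc_RW_pivpiv_iff hcc' h1' h2').2 (hpp ((tc_RW_pivpiv_iff hcc' h1 h2).1 hW))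
      · exact tc_RW_refl x' (by simp only [Matrix.cons_val_zero]; omega) (by simp only [Matrix.cons_val_zero]; omega) (by simp only [Matrix.cons_val_one, Matrix.cons_val_zero]; omega)
          (by simp only [Matrix.cons_val_one, Matrix.cons_val_zero]; omega)
  have hkind : ∀ {P : Site 2}, (cmkBdp i c P ∨ cmkBdp i c' P) → (cmkBd i P ∨ P = ![i + 1, c] ∨ P = ![i + 1, c']) := by
    rintro P ((h | h) | (h | h))
    exacts [Or.inl h, Or.inr (Or.inl h), Or.inl h, Or.inr (Or.inr h)]
  rintro ⟨P, Q⟩ ⟨hP, hQ, hW⟩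
  exact ⟨hP, hQ, core2 P Q (hkind hP) (hkind hQ) hW⟩

/-- (B) RIGIDITY: between two configurations with the cut rows `c ≤ c'` agreeing as environments on the strip rows
`[c-2, c'+2]`, the boundary/pivot window reachabilities coincide. [folklore] -/
theorem tc_RWp_rigid {x' : Obs} (hcc' : c ≤ c') (h1 : IsCut i c (pinnedStat i x)) (h2 : IsCut i c' (pinnedStat i x))
    (h1' : IsCut i c (pinnedStat i x')) (h2' : IsCut i c' (pinnedStat i x'))
    (hag : EnvAgree i (c - 2) (c' + 2) (pinnedStat i x) (pinnedStat i x')) : cmkRWp i c c' x = cmkRWp i c c' x' :=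
  Subset.antisymm (tc_RWp_sub hcc' h1 h2 h1' h2' hag) (tc_RWp_sub hcc' h1' h2' h1 h2 (envAgree_symm hag))

end Rigid

/-! ## The registered stub -/

/-- THE TWO-CUT COMBINATORICS (registered stub `stub_TwoCutComb`): (C) the two-cut characterisation, (D) the
assembly of the upper half-diagram with pivot at `c`, (B) the rigidity of the boundary/pivot window reachability
under `EnvAgree`, (E) the irrelevance of the row-`c` flags. [folklore] -/
theorem stub_TwoCutComb : ∀ i : ℤ, TwoCutComb i :=
  fun i => ⟨fun c c' x hc hc' => tc_twoCut_iff i c c' x hc hc',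
    fun _ _ _ hc hc' _ h2 => tc_UpDp_eq_comb2 hc hc' h2,
    fun _ _ _ _ hc hc' h1 h2 h1' h2' hag => tc_RWp_rigid (by omega) h1 h2 h1' h2' hag,
    fun c c' x _ _ h1 _ => tc_RW_flat i c c c' x h1⟩

end Summit.CriticalPhenomena.CardyFormulaZ2.Theorems.IKLinearTransport.PinnedDiagramExchange
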